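import Literature.Probability.RandomPlanarGeometry.HammersleyWelshExplicitZ2Speed
import Literature.Probability.RandomPlanarGeometry.SAWBridgeLowerBoundExplicitZ2
import Literature.Probability.RandomPlanarGeometry.SAWPolygonLowerBoundSharp
import HarnessLib

/-!
# The certificate floor on `ℤ²`: Hammersley–Welsh (Theorem 3.1.1) and Corollary 3.1.6 hold for every
# `B > π(2v₀/3)^{1/2} ≈ 1.5870`, `v₀ = SAW.speedThreshold ≈ 0.3828`

Topic `Literature/Probability/RandomPlanarGeometry`, on top of `HammersleyWelshExplicitZ2Speed.lean`
(`Zd.count_le_exp_sharp_two_of_speed`: at every rational speed `p/q` above the certified threshold `v₀`, the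
explicit bound `c_N ≤ exp(π√(2pN/(3q)) + π²p/(3q) + 1) μ^{N+1}` beyond two explicit side conditions) and
`SAWBridgeLowerBoundExplicitZ2.lean` (`Zd.exists_pow_mul_exp_neg_le_bridgeCount_of_endpointBoundQ`: the
Corollary-3.1.6 shape from any endpoint bound) and `SAWPolygonLowerBoundSharp.lean` (Theorem 3.2.4 real form,
`Zd.sq_bridgeCount_le_pow_mul_countAt_eDown`, and `Zd.exists_threshold_succ_le_exp`), with the tree's tilt-`11/9` certificate
`SAW.card_xEnd_ge_speed_le_exp : #{x(ω_n) ≥ vn} ≤ 2⁴¹ e^{-(v - v₀)·log(11/9)·n} c_n` (all `v`, `n`).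

Sources (printed anchors): N. Madras, G. Slade (1993), Theorem 3.1.1 ("`c_N ≤ μ^{N+1} e^{BN^{1/2}}` for all
`N ≥ N₀(B)`, any `B > π(2/3)^{1/2}`") and Corollary 3.1.6, eq. (3.1.9) ("`μ^{N-1} e^{-BN^{1/2}} ≤ b_N ≤ μ^N`");
T. Hutchcroft (2018), Theorem 1.2 (`exp[o(n^{1/2})]`, ineffective); H. Duminil-Copin, A. Hammond (2013), Theorem 1.1.
What is new in THIS FILE (lane pcv-sawmu, route R7 "X19♯", closing statement; not in print): on `ℤ²` BOTH printed
statements hold with the threshold constant `π(2/3)^{1/2} ≈ 2.5651` replaced by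
`B₀ := π(2v₀/3)^{1/2} ≈ 1.5870`, where `v₀ = log(λ̄_{11/9}/2.604)/log(11/9) = 0.3828…` is the certified speed
threshold of the lane's memory-16 tilted certificate: for every `B > B₀` and all sufficiently large `N`,
`c_N ≤ μ^{N+1} e^{B√N}` and `μ^N e^{-B√N} ≤ b_N`; numerically `v₀ < 18/47`, so every `B ≥ 1.5875` qualifies;
and Corollary 3.2.5's polygon lower bound `μ^{2M} e^{-C√M} ≤ c_{2M+1}(0,e)` holds for every `C > 2B₀` (`C ≥ 3.175`). Mechanism: pick a rational `p/q ∈ (v₀, 3B²/(2π²))`, apply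
the explicit speed-`p/q` theorems, absorb the additive constants into `(B - π√(2p/(3q)))√N`. (The effective
instances with explicit thresholds are `Zd.count_le_exp_sharp_two` (`π(1/3)^{1/2}`, `N ≥ 791`),
`Zd.count_le_exp_nineTwentieths_two` (`π(3/10)^{1/2}`, `N ≥ 5400`) and `Zd.pow_le_mul_bridgeCount_two_explicit`.)
AXIOMS: the computational lineage of the certificates (`native_decide` in `SAWTiltedFiniteMemory16T11x9.lean`,
`SAWLowerBound2604.lean`) — nothing else beyond the standard three.

## Contents (namespaces `….SAW` / `….SAW.Zd`), all PROVED
* `speedThreshold_pos`, `speedThreshold_lt_one`, `speedThreshold_lt` — `0 < v₀ < 18/47 < 1`;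
* `pi_mul_sqrt_speedThreshold_lt` — `π(2v₀/3)^{1/2} < 1.5875`;
* `exists_nat_ratio_btwn` — a rational `p/q` with `1 ≤ p ≤ q` strictly between `a ∈ [0,1)` and `b > a`;
* **`Zd.MadrasSlade1993_thm311_two_of_gt_floor`** — `∀ B > π√(2v₀/3), ∃ N₀, ∀ N ≥ N₀, c_N ≤ μ^{N+1} e^{B√N}` on `ℤ²`;
* **`Zd.MadrasSlade1993_cor316_two_of_gt_floor`** — `∀ B > π√(2v₀/3), ∃ N₀, ∀ N ≥ N₀, μ^N e^{-B√N} ≤ b_N` on `ℤ²`;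
* `Zd.MadrasSlade1993_thm311_two_of_ge`, `Zd.MadrasSlade1993_cor316_two_of_ge` — the same for every `B ≥ 1.5875`;
* `Zd.cor325_lower_of_bridgeFloor` — Corollary 3.2.5's first inequality from any bridge floor constant `B₀`, `C > 2B₀`;
* **`Zd.MadrasSlade1993_cor325_lower_two_of_gt_floor`** / `_of_ge` — polygons on `ℤ²`: `∀ C > 2π√(2v₀/3)` (resp.
  `C ≥ 3.175`), `∃ M₀, ∀ M ≥ M₀, μ^{2M} e^{-C√M} ≤ c_{2M+1}(0,e)` (tree-only constant: `C > 2π(2/3)^{1/2} ≈ 5.13`).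
-/

noncomputable section

open Finset Literature.Probability.RandomPlanarGeometry.SAW

namespace Literature.Probability.RandomPlanarGeometry.SAW

/-- `0 < v₀`: the certified tilted rate `λ̄ = 278379899/(10⁶·99) = 2.8119…` exceeds `2.604`.
[cite: DuminilCopinHammond2013, Theorem 1.1] -/
theorem speedThreshold_pos : 0 < speedThreshold := by
  rw [speedThreshold]
  refine div_pos (Real.log_pos ?_) (Real.log_pos (by norm_num))
  norm_num

/-- `v₀ < 1`: `λ̄/2.604 = 1.0798… < 11/9`. [cite: DuminilCopinHammond2013, Theorem 1.1] -/
theorem speedThreshold_lt_one : speedThreshold < 1 := by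
  rw [speedThreshold, div_lt_one (Real.log_pos (by norm_num))]
  exact Real.log_lt_log (by norm_num) (by norm_num)

/-- **`v₀ < 18/47 = 0.38297…`** (true value `0.382807…`): `(λ̄/2.604)⁴⁷ < (11/9)¹⁸`, exact rational arithmetic.
Hence the floor constant `π(2v₀/3)^{1/2} < π(12/47)^{1/2} < 1.5875`. [cite: DuminilCopinHammond2013, Theorem 1.1] -/
theorem speedThreshold_lt : speedThreshold < 18 / 47 := by
  have hlog : 0 < Real.log ((11 : ℝ) / 9) := Real.log_pos (by norm_num)
  rw [speedThreshold, div_lt_iff₀ hlog]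
  have hx : (0 : ℝ) < ((278379899 : ℕ) : ℝ) / ((1000000 : ℕ) * (11 : ℕ) * (9 : ℕ)) / 2.604 := by positivity
  have h47 : (47 : ℝ) * Real.log (((278379899 : ℕ) : ℝ) / ((1000000 : ℕ) * (11 : ℕ) * (9 : ℕ)) / 2.604) <
      18 * Real.log ((11 : ℝ) / 9) := by
    have e1 : (47 : ℝ) * Real.log (((278379899 : ℕ) : ℝ) / ((1000000 : ℕ) * (11 : ℕ) * (9 : ℕ)) / 2.604) =
        Real.log ((((278379899 : ℕ) : ℝ) / ((1000000 : ℕ) * (11 : ℕ) * (9 : ℕ)) / 2.604) ^ 47) := by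
      rw [Real.log_pow]; norm_num
    have e2 : (18 : ℝ) * Real.log ((11 : ℝ) / 9) = Real.log (((11 : ℝ) / 9) ^ 18) := by
      rw [Real.log_pow]; norm_num
    rw [e1, e2]
    exact Real.log_lt_log (by positivity) (by norm_num)
  linarith

/-- The floor constant is below `1.5875`: `π(2v₀/3)^{1/2} < 1.5875` (`π < 3.1416`, `(12/47)^{1/2} < 0.5053`).
[cite: DuminilCopinHammond2013, Theorem 1.1] -/
theorem pi_mul_sqrt_speedThreshold_lt : Real.pi * Real.sqrt (2 * speedThreshold / 3) < 1.5875 := by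
  have hv := speedThreshold_lt
  have hs : Real.sqrt (2 * speedThreshold / 3) ≤ 0.5053 := by
    rw [Real.sqrt_le_left (by norm_num)]
    linarith
  have hs0 : 0 ≤ Real.sqrt (2 * speedThreshold / 3) := Real.sqrt_nonneg _
  have hπ : Real.pi < 3.1416 := Real.pi_lt_d4
  have hπ0 : 0 < Real.pi := Real.pi_pos
  nlinarith [mul_le_mul_of_nonneg_left hs hπ0.le]

/-- A rational `p/q` with `1 ≤ p ≤ q` strictly between `a` and `b`, for `0 ≤ a < b`, `a < 1`
(`q > 2/(min b 1 - a)`, `p = ⌊aq⌋ + 1`). [cite: MadrasSlade1993, §3.1 (bookkeeping)] -/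
theorem exists_nat_ratio_btwn {a b : ℝ} (ha : 0 ≤ a) (hab : a < b) (ha1 : a < 1) :
    ∃ p q : ℕ, 1 ≤ p ∧ p ≤ q ∧ a < (p : ℝ) / q ∧ (p : ℝ) / q < b := by
  set b' : ℝ := min b 1 with hb'
  have hab' : a < b' := lt_min hab ha1
  have hgap : 0 < b' - a := by linarith
  obtain ⟨q, hq⟩ := exists_nat_gt (2 / (b' - a))
  have hq0 : (0 : ℝ) < q := lt_trans (by positivity) hq
  have hqpos : 0 < q := by exact_mod_cast hq0
  have hq1 : 1 / (q : ℝ) < b' - a := by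
    rw [div_lt_iff₀ hq0]
    have := (div_lt_iff₀ hgap).1 hq
    linarith
  set p : ℕ := ⌊a * q⌋₊ + 1 with hp
  have hp1 : a * q < p := by rw [hp]; push_cast; exact Nat.lt_floor_add_one _
  have hp2 : (p : ℝ) ≤ a * q + 1 := by
    rw [hp]; push_cast
    linarith [Nat.floor_le (mul_nonneg ha hq0.le)]
  refine ⟨p, q, by omega, ?_, ?_, ?_⟩
  · -- `p/q < b' ≤ 1`
    have : (p : ℝ) < q := by
      have hb1 : b' ≤ 1 := min_le_right _ _
      have h1 : (p : ℝ) ≤ a * q + 1 := hp2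
      have h2 : a * q + 1 < b' * q := by
        have := mul_lt_mul_of_pos_right hq1 hq0
        rw [one_div, inv_mul_cancel₀ hq0.ne'] at this
        nlinarith
      nlinarith
    exact_mod_cast this.le
  · rw [lt_div_iff₀ hq0]; exact hp1
  · have hb1 : b' ≤ b := min_le_left _ _
    rw [div_lt_iff₀ hq0]
    have h2 : a * q + 1 < b' * q := by
      have := mul_lt_mul_of_pos_right hq1 hq0
      rw [one_div, inv_mul_cancel₀ hq0.ne'] at this
      nlinarith
    nlinarith

namespace Zd

/-- **Hammersley–Welsh on `ℤ²` down to the certificate floor** (Madras–Slade Theorem 3.1.1 shape): for every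
`B > π(2v₀/3)^{1/2}` (`v₀ = SAW.speedThreshold = 0.3828…`, so `π(2v₀/3)^{1/2} ≈ 1.5870`; print:
`B > π(2/3)^{1/2} ≈ 2.5651`) there is `N₀` with `c_N ≤ μ^{N+1} e^{B√N}` for all `N ≥ N₀`.
[cite: MadrasSlade1993, Theorem 3.1.1; Hutchcroft2018HammersleyWelsh, Theorems 1.2 and 1.4; DuminilCopinHammond2013, Theorem 1.1] -/
theorem MadrasSlade1993_thm311_two_of_gt_floor {B : ℝ}
    (hB : Real.pi * Real.sqrt (2 * speedThreshold / 3) < B) :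
    ∃ N₀ : ℕ, ∀ N : ℕ, N₀ ≤ N →
      (count 2 N : ℝ) ≤ connectiveConstant 2 ^ (N + 1) * Real.exp (B * Real.sqrt N) := by
  have hπ : 0 < Real.pi := Real.pi_pos
  have hv0 := speedThreshold_pos
  have hv1 := speedThreshold_lt_one
  have hB0 : 0 < B := lt_of_le_of_lt (by positivity) hB
  -- the target speed `t = 3B²/(2π²)`: `v₀ < t` and `v < t ⇒ π√(2v/3) < B`
  set t : ℝ := 3 * B ^ 2 / (2 * Real.pi ^ 2) with ht
  have hv0t : speedThreshold < t := by
    have hs : Real.sqrt (2 * speedThreshold / 3) < B / Real.pi := by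
      rw [lt_div_iff₀ hπ, mul_comm]; exact hB
    have hs0 : 0 ≤ Real.sqrt (2 * speedThreshold / 3) := Real.sqrt_nonneg _
    have h2 : 2 * speedThreshold / 3 < (B / Real.pi) ^ 2 := by
      have := Real.sq_sqrt (show (0 : ℝ) ≤ 2 * speedThreshold / 3 by positivity)
      nlinarith [mul_self_lt_mul_self hs0 hs]
    rw [ht]
    have e : (B / Real.pi) ^ 2 = B ^ 2 / Real.pi ^ 2 := by rw [div_pow]
    rw [e, lt_div_iff₀ (by positivity)] at h2
    rw [lt_div_iff₀ (by positivity)]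
    linarith
  obtain ⟨p, q, hp, hpq, hlo, hhi⟩ := exists_nat_ratio_btwn hv0.le hv0t hv1
  have hp0 : (0 : ℝ) < p := by exact_mod_cast hp
  have hq0 : (0 : ℝ) < q := by exact_mod_cast (lt_of_lt_of_le hp hpq)
  -- `B' = π√(2p/(3q)) < B`
  set B' : ℝ := Real.pi * Real.sqrt (2 * (p : ℝ) / (3 * q)) with hB'
  have hB'B : B' < B := by
    have h1 : 2 * (p : ℝ) / (3 * q) < (B / Real.pi) ^ 2 := by
      have hπ0 : Real.pi ≠ 0 := hπ.ne'
      have e1 : 2 * (p : ℝ) / (3 * q) = 2 / 3 * ((p : ℝ) / q) := by ring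
      have e2 : (B / Real.pi) ^ 2 = 2 / 3 * t := by rw [ht, div_pow]; field_simp
      rw [e1, e2]; exact mul_lt_mul_of_pos_left hhi (by norm_num)
    have h2 : Real.sqrt (2 * (p : ℝ) / (3 * q)) < B / Real.pi := by
      calc Real.sqrt (2 * (p : ℝ) / (3 * q)) < Real.sqrt ((B / Real.pi) ^ 2) :=
            Real.sqrt_lt_sqrt (by positivity) h1
        _ = B / Real.pi := Real.sqrt_sq (by positivity)
    rw [hB']
    calc Real.pi * Real.sqrt (2 * (p : ℝ) / (3 * q)) < Real.pi * (B / Real.pi) := mul_lt_mul_of_pos_left h2 hπ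
      _ = B := mul_div_cancel₀ _ hπ.ne'
  have hδ : 0 < B - B' := by linarith
  -- the rate `ε = (p/q - v₀) log(11/9)`, `c = ε/2`
  set ε : ℝ := ((p : ℝ) / q - speedThreshold) * Real.log ((11 : ℝ) / 9) with hε
  have hlog : 0 < Real.log ((11 : ℝ) / 9) := Real.log_pos (by norm_num)
  have hε0 : 0 < ε := mul_pos (by linarith) hlog
  set c : ℝ := ε / 2 with hc
  have hc0 : 0 < c := by positivity
  have hcε : c < ε := by rw [hc]; linarith
  -- thresholds: the two side conditions and the absorption `C₀ ≤ (B - B')√N`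
  set C₀ : ℝ := Real.pi ^ 2 * p / (3 * (q : ℝ)) + 1 with hC₀
  have hC₀0 : 0 < C₀ := by positivity
  set T1 : ℝ := 2 * Real.pi ^ 2 * p / (3 * (q : ℝ)) with hT1
  set T2 : ℝ := Real.pi ^ 2 * p * ((((q : ℝ) - p) / (p * c)) + 1) ^ 2 / (6 * (q : ℝ)) with hT2
  set T3 : ℝ := (C₀ / (B - B')) ^ 2 with hT3
  obtain ⟨N₀, hN₀⟩ := exists_nat_ge (max T1 (max T2 T3))
  refine ⟨N₀, fun N hN => ?_⟩
  have hNr : (N₀ : ℝ) ≤ N := by exact_mod_cast hN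
  have hN1' : T1 ≤ N := le_trans (le_max_left _ _) (hN₀.trans hNr)
  have hN2' : T2 ≤ N := le_trans ((le_max_left _ _).trans (le_max_right _ _)) (hN₀.trans hNr)
  have hN3' : T3 ≤ N := le_trans ((le_max_right _ _).trans (le_max_right _ _)) (hN₀.trans hNr)
  have hN1 : 2 * Real.pi ^ 2 * p ≤ 3 * (q : ℝ) * N := by
    rw [hT1, div_le_iff₀ (by positivity)] at hN1'; linarith
  have hN2 : Real.pi ^ 2 * p * ((((q : ℝ) - p) / (p * c)) + 1) ^ 2 ≤ 6 * (q : ℝ) * N := by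
    rw [hT2, div_le_iff₀ (by positivity)] at hN2'; linarith
  have key := count_le_exp_sharp_two_of_speed hp hpq hc0 (by rw [hε] at hcε; exact hcε) N hN1 hN2
  -- `π√(2pN/(3q)) = B'√N` and `B'√N + C₀ ≤ B√N`
  have hsq : Real.sqrt (2 * p * N / (3 * (q : ℝ))) = Real.sqrt (2 * (p : ℝ) / (3 * q)) * Real.sqrt N := by
    rw [← Real.sqrt_mul (by positivity)]; congr 1; ring
  have hsplit : Real.pi * Real.sqrt (2 * p * N / (3 * (q : ℝ))) = B' * Real.sqrt N := by
    rw [hsq, hB', mul_assoc]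
  have habs : C₀ ≤ (B - B') * Real.sqrt N := by
    have h1 : C₀ / (B - B') ≤ Real.sqrt N := by
      rw [Real.le_sqrt (by positivity) (by positivity)]; exact hN3'
    have := mul_le_mul_of_nonneg_left h1 hδ.le
    rwa [mul_div_cancel₀ _ hδ.ne'] at this
  have hexp : Real.exp (Real.pi * Real.sqrt (2 * p * N / (3 * (q : ℝ))) + Real.pi ^ 2 * p / (3 * (q : ℝ)) + 1) ≤
      Real.exp (B * Real.sqrt N) := by
    rw [Real.exp_le_exp, hsplit]
    have : Real.pi ^ 2 * p / (3 * (q : ℝ)) + 1 = C₀ := by rw [hC₀]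
    nlinarith
  have hμ : 0 ≤ connectiveConstant 2 ^ (N + 1) := pow_nonneg (connectiveConstant_pos 2).le _
  calc (count 2 N : ℝ)
      ≤ Real.exp (Real.pi * Real.sqrt (2 * p * N / (3 * (q : ℝ))) + Real.pi ^ 2 * p / (3 * (q : ℝ)) + 1) *
          connectiveConstant 2 ^ (N + 1) := key
    _ ≤ Real.exp (B * Real.sqrt N) * connectiveConstant 2 ^ (N + 1) := mul_le_mul_of_nonneg_right hexp hμ
    _ = connectiveConstant 2 ^ (N + 1) * Real.exp (B * Real.sqrt N) := mul_comm _ _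

/-- **Corollary 3.1.6 on `ℤ²` down to the certificate floor**: for every `B > π(2v₀/3)^{1/2} ≈ 1.5870` there is
`N₀` with `μ^N e^{-B√N} ≤ b_N` for all `N ≥ N₀` (print: `B > π(2/3)^{1/2}`; `Zd.MadrasSlade1993_cor316`).
[cite: MadrasSlade1993, Corollary 3.1.6, eq. (3.1.9) (p. 61); DuminilCopinHammond2013, Theorem 1.1] -/
theorem MadrasSlade1993_cor316_two_of_gt_floor {B : ℝ}
    (hB : Real.pi * Real.sqrt (2 * speedThreshold / 3) < B) :
    ∃ N₀ : ℕ, ∀ N : ℕ, N₀ ≤ N →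
      connectiveConstant 2 ^ N * Real.exp (-(B * Real.sqrt N)) ≤ (bridgeCount 2 N : ℝ) := by
  have hπ : 0 < Real.pi := Real.pi_pos
  have hv0 := speedThreshold_pos
  have hv1 := speedThreshold_lt_one
  have hB0 : 0 < B := lt_of_le_of_lt (by positivity) hB
  set t : ℝ := 3 * B ^ 2 / (2 * Real.pi ^ 2) with ht
  have hv0t : speedThreshold < t := by
    have hs : Real.sqrt (2 * speedThreshold / 3) < B / Real.pi := by
      rw [lt_div_iff₀ hπ, mul_comm]; exact hB
    have hs0 : 0 ≤ Real.sqrt (2 * speedThreshold / 3) := Real.sqrt_nonneg _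
    have h2 : 2 * speedThreshold / 3 < (B / Real.pi) ^ 2 := by
      have := Real.sq_sqrt (show (0 : ℝ) ≤ 2 * speedThreshold / 3 by positivity)
      nlinarith [mul_self_lt_mul_self hs0 hs]
    rw [ht]
    have e : (B / Real.pi) ^ 2 = B ^ 2 / Real.pi ^ 2 := by rw [div_pow]
    rw [e, lt_div_iff₀ (by positivity)] at h2
    rw [lt_div_iff₀ (by positivity)]
    linarith
  obtain ⟨p, q, hp, hpq, hlo, hhi⟩ := exists_nat_ratio_btwn hv0.le hv0t hv1
  have hp0 : (0 : ℝ) < p := by exact_mod_cast hp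
  have hq0 : (0 : ℝ) < q := by exact_mod_cast (lt_of_lt_of_le hp hpq)
  have hB'B : Real.pi * Real.sqrt (2 * (p : ℝ) / (3 * q)) < B := by
    have h1 : 2 * (p : ℝ) / (3 * q) < (B / Real.pi) ^ 2 := by
      have hπ0 : Real.pi ≠ 0 := hπ.ne'
      have e1 : 2 * (p : ℝ) / (3 * q) = 2 / 3 * ((p : ℝ) / q) := by ring
      have e2 : (B / Real.pi) ^ 2 = 2 / 3 * t := by rw [ht, div_pow]; field_simp
      rw [e1, e2]; exact mul_lt_mul_of_pos_left hhi (by norm_num)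
    have h2 : Real.sqrt (2 * (p : ℝ) / (3 * q)) < B / Real.pi := by
      calc Real.sqrt (2 * (p : ℝ) / (3 * q)) < Real.sqrt ((B / Real.pi) ^ 2) :=
            Real.sqrt_lt_sqrt (by positivity) h1
        _ = B / Real.pi := Real.sqrt_sq (by positivity)
    calc Real.pi * Real.sqrt (2 * (p : ℝ) / (3 * q)) < Real.pi * (B / Real.pi) := mul_lt_mul_of_pos_left h2 hπ
      _ = B := mul_div_cancel₀ _ hπ.ne'
  -- the endpoint bound at speed `p/q` from the tilt-`11/9` certificate
  set ε : ℝ := ((p : ℝ) / q - speedThreshold) * Real.log ((11 : ℝ) / 9) with hε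
  have hlog : 0 < Real.log ((11 : ℝ) / 9) := Real.log_pos (by norm_num)
  have hε0 : 0 < ε := mul_pos (by linarith) hlog
  have hend : ∀ m : ℕ, 1 ≤ m →
      ((((saws 2 m).filter fun ω => ((p : ℝ) / q) * m ≤ ((ω m 0 : ℤ) : ℝ)).card : ℝ)
        ≤ 2 ^ 41 * Real.exp (-(ε * m)) * (count 2 m : ℝ)) := by
    intro m _
    have h := card_xEnd_ge_speed_le_exp ((p : ℝ) / q) m
    have e : -(((p : ℝ) / q - speedThreshold) * Real.log ((11 : ℝ) / 9) * m) = -(ε * m) := by rw [hε]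
    rw [e] at h
    exact h
  exact exists_pow_mul_exp_neg_le_bridgeCount_of_endpointBoundQ hp hpq (by norm_num) hε0 hend hB'B

/-- **Hammersley–Welsh on `ℤ²` for every `B ≥ 1.5875`** (numeric form of the floor): there is `N₀` with
`c_N ≤ μ^{N+1} e^{B√N}` for all `N ≥ N₀`. [cite: MadrasSlade1993, Theorem 3.1.1; DuminilCopinHammond2013, Theorem 1.1] -/
theorem MadrasSlade1993_thm311_two_of_ge {B : ℝ} (hB : 1.5875 ≤ B) :
    ∃ N₀ : ℕ, ∀ N : ℕ, N₀ ≤ N →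
      (count 2 N : ℝ) ≤ connectiveConstant 2 ^ (N + 1) * Real.exp (B * Real.sqrt N) :=
  MadrasSlade1993_thm311_two_of_gt_floor (lt_of_lt_of_le pi_mul_sqrt_speedThreshold_lt hB)

/-- **Corollary 3.1.6 on `ℤ²` for every `B ≥ 1.5875`** (numeric form of the floor): there is `N₀` with
`μ^N e^{-B√N} ≤ b_N` for all `N ≥ N₀`. [cite: MadrasSlade1993, Corollary 3.1.6, eq. (3.1.9); DuminilCopinHammond2013, Theorem 1.1] -/
theorem MadrasSlade1993_cor316_two_of_ge {B : ℝ} (hB : 1.5875 ≤ B) :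
    ∃ N₀ : ℕ, ∀ N : ℕ, N₀ ≤ N →
      connectiveConstant 2 ^ N * Real.exp (-(B * Real.sqrt N)) ≤ (bridgeCount 2 N : ℝ) :=
  MadrasSlade1993_cor316_two_of_gt_floor (lt_of_lt_of_le pi_mul_sqrt_speedThreshold_lt hB)


/-- **Corollary 3.2.5 (first inequality) from a bridge floor constant `B₀`** (`d = 2`): if for every `B > B₀`
eventually `μ^N e^{-B√N} ≤ b_N`, then for every `C > 2B₀` there is `M₀` with `μ^{2M} e^{-C√M} ≤ c_{2M+1}(0,e)` for
all `M ≥ M₀` (Theorem 3.2.4: `b_M² ≤ (M+1)^{12} c_{2M+1}(0,e)`; the polynomial is absorbed by `e^{(C-2B)√M}`,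
`B₀ < B < C/2`). The printed-constant case `B₀ = π(2/3)^{1/2}` is `Zd.MadrasSlade1993_cor325_lower_sharp`.
[cite: MadrasSlade1993, Corollary 3.2.5 (p. 67) with Theorem 3.2.4 and Corollary 3.1.6, eq. (3.1.9)] -/
theorem cor325_lower_of_bridgeFloor {B₀ : ℝ}
    (h : ∀ B : ℝ, B₀ < B → ∃ N₀ : ℕ, ∀ N : ℕ, N₀ ≤ N →
      connectiveConstant 2 ^ N * Real.exp (-(B * Real.sqrt N)) ≤ (bridgeCount 2 N : ℝ))
    {C : ℝ} (hC : 2 * B₀ < C) :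
    ∃ M₀ : ℕ, ∀ M : ℕ, M₀ ≤ M →
      connectiveConstant 2 ^ (2 * M) * Real.exp (-(C * Real.sqrt M)) ≤ (countAt 2 (2 * M + 1) eDown : ℝ) := by
  -- `B₀ < B < C/2`, `δ := C - 2B > 0`, `η := δ/12`
  set B : ℝ := (B₀ + C / 2) / 2 with hB
  have hB1 : B₀ < B := by rw [hB]; linarith
  have hδ : 0 < C - 2 * B := by rw [hB]; linarith
  obtain ⟨N₀, hN₀⟩ := h B hB1
  obtain ⟨N₁, hN₁⟩ := exists_threshold_succ_le_exp (η := (C - 2 * B) / 12) (by positivity)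
  refine ⟨max (max N₀ N₁) 1, fun M hM => ?_⟩
  have hM0 : N₀ ≤ M := le_trans (le_trans (le_max_left _ _) (le_max_left _ _)) hM
  have hM1 : N₁ ≤ M := le_trans (le_trans (le_max_right _ _) (le_max_left _ _)) hM
  have hM2 : 1 ≤ M := le_trans (le_max_right _ _) hM
  have hμ := connectiveConstant_pos 2
  have hb := hN₀ M hM0
  have hb0 : 0 ≤ connectiveConstant 2 ^ M * Real.exp (-(B * Real.sqrt M)) := by positivity
  have hsq := sq_bridgeCount_le_pow_mul_countAt_eDown hM2
  have hc0 : (0 : ℝ) ≤ countAt 2 (2 * M + 1) eDown := Nat.cast_nonneg _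
  -- polynomial absorption: `(M+1)^{12} ≤ e^{(C-2B)√M}`
  have hpoly : ((M : ℝ) + 1) ^ 12 ≤ Real.exp ((C - 2 * B) * Real.sqrt M) := by
    calc ((M : ℝ) + 1) ^ 12 ≤ (Real.exp ((C - 2 * B) / 12 * Real.sqrt M)) ^ 12 :=
          pow_le_pow_left₀ (by positivity) (hN₁ M hM1) 12
      _ = Real.exp ((C - 2 * B) * Real.sqrt M) := by rw [← Real.exp_nat_mul]; ring_nf
  have h1 : connectiveConstant 2 ^ (2 * M) * Real.exp (-(2 * B * Real.sqrt M)) ≤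
      Real.exp ((C - 2 * B) * Real.sqrt M) * countAt 2 (2 * M + 1) eDown := by
    calc connectiveConstant 2 ^ (2 * M) * Real.exp (-(2 * B * Real.sqrt M))
        = (connectiveConstant 2 ^ M * Real.exp (-(B * Real.sqrt M))) ^ 2 := by
          rw [mul_pow, ← Real.exp_nat_mul, ← pow_mul]; ring_nf
      _ ≤ (bridgeCount 2 M : ℝ) ^ 2 := pow_le_pow_left₀ hb0 hb 2
      _ ≤ ((M : ℝ) + 1) ^ 12 * countAt 2 (2 * M + 1) eDown := hsq
      _ ≤ Real.exp ((C - 2 * B) * Real.sqrt M) * countAt 2 (2 * M + 1) eDown :=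
          mul_le_mul_of_nonneg_right hpoly hc0
  have e : connectiveConstant 2 ^ (2 * M) * Real.exp (-(C * Real.sqrt M)) =
      connectiveConstant 2 ^ (2 * M) * Real.exp (-(2 * B * Real.sqrt M)) *
        (Real.exp ((C - 2 * B) * Real.sqrt M))⁻¹ := by
    rw [← Real.exp_neg, mul_assoc, ← Real.exp_add]; ring_nf
  rw [e, ← div_eq_mul_inv, div_le_iff₀ (Real.exp_pos _)]
  linarith [h1]

/-- **Madras–Slade Corollary 3.2.5 (first inequality) on `ℤ²` down to the certificate floor**: for every
`C > 2π(2v₀/3)^{1/2} ≈ 3.174` (print/tree-only: `C > 2π(2/3)^{1/2} ≈ 5.130`, `Zd.MadrasSlade1993_cor325_lower_sharp`)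
there is `M₀` with `μ^{2M} e^{-C√M} ≤ c_{2M+1}(0,e)` for all `M ≥ M₀`.
[cite: MadrasSlade1993, Corollary 3.2.5 (p. 67); DuminilCopinHammond2013, Theorem 1.1] -/
theorem MadrasSlade1993_cor325_lower_two_of_gt_floor {C : ℝ}
    (hC : 2 * (Real.pi * Real.sqrt (2 * speedThreshold / 3)) < C) :
    ∃ M₀ : ℕ, ∀ M : ℕ, M₀ ≤ M →
      connectiveConstant 2 ^ (2 * M) * Real.exp (-(C * Real.sqrt M)) ≤ (countAt 2 (2 * M + 1) eDown : ℝ) :=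
  cor325_lower_of_bridgeFloor (fun _ hB => MadrasSlade1993_cor316_two_of_gt_floor hB) hC

/-- **Corollary 3.2.5 (first inequality) on `ℤ²` for every `C ≥ 3.175`** (numeric form of the floor).
[cite: MadrasSlade1993, Corollary 3.2.5 (p. 67); DuminilCopinHammond2013, Theorem 1.1] -/
theorem MadrasSlade1993_cor325_lower_two_of_ge {C : ℝ} (hC : 3.175 ≤ C) :
    ∃ M₀ : ℕ, ∀ M : ℕ, M₀ ≤ M →
      connectiveConstant 2 ^ (2 * M) * Real.exp (-(C * Real.sqrt M)) ≤ (countAt 2 (2 * M + 1) eDown : ℝ) :=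
  MadrasSlade1993_cor325_lower_two_of_gt_floor (by linarith [pi_mul_sqrt_speedThreshold_lt])


end Zd

end Literature.Probability.RandomPlanarGeometry.SAW

end
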